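import Literature.AnabelianGeometry.AbsoluteAnabelian.AbsTopIII.KummerIntrinsic
import HarnessLib

/-!
# [AbsTopIII] Thm. 1.9 (c) / Prop. 1.8: the subgroup `P_U ⊆ H¹(Π_U, M_X)` and the NF-characterizations

Mochizuki, *Topics in Absolute Anabelian Geometry III*, §1 (manuscript pages, lit key
`paper:url-5493eb38cbb7`): Prop. 1.8 p. 36 "write `P_U ⊆ H¹(Π_U, M_X)` for the inverse image of the
submodule of `⊕_{x ∈ S} ℤ ⊆ ⊕_{x ∈ S} Ẑ` determined by the cuspidal principal divisors, i.e. the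
principal divisors supported on the cusps [cf. Proposition 1.6, (iii)]"; Prop. 1.8 (i), (ii)
(characterization of the Kummer classes of nonconstant NF-rational functions and of NF-constants
among the classes of `P_U`, by restriction to decomposition groups of NF-points); Thm. 1.9 (c) p. 37
"one constructs the subgroup `P_U ⊆ H¹(Π_U, μ_Ẑ(Π_U))` determined by the cuspidal principal divisors via
the isomorphisms of (b) and the characterization of principal divisors given in Proposition 1.6,
(ii) [cf. also the decomposition groups of (a); Proposition 1.6, (iii)]."

`KummerIntrinsic.lean` typed Prop. 1.8 only for Kummer classes of UNITS, recording that `P_U` itself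
would need the natural synchronizations `I_x ⥲ M_X`.  This file gives `P_U` a tree definition that
avoids them: by the exact sequence of Prop. 1.6 (iii),
`1 → (k^×)^∧ → H¹(Π_U, M_X) →ᴰ ⊕_{x ∈ S} Ẑ` with `D(κ_U(f)) = div(f)`, one has
`D⁻¹(principal cuspidal divisors) = κ_U(Γ(U, 𝒪_U^×)) + Ker D` and
`Ker D = (k^×)^∧ = Im(H¹(G_k, M_X)) = Ker(H¹(Π_U, M_X) → H¹(Δ_U, M_X))`; so we DEFINE

* `IntrinsicKummerModel.PU M h hX := κ_U(Γ(U, 𝒪_U^×)) ⊔ Ker(res_{Δ_U})` — an additive subgroup of the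
  REAL `H¹(Π_U, M_X(Ẑ))` (`cyclotomeModH1`), which coincides with the `P_U` of the text whenever
  Prop. 1.6 (iii) holds for the model (documented; the text's own route through Thm. 1.9 (b) and
  Prop. 1.6 (ii) is the GROUP-THEORETIC construction, which this model-relative definition does not
  claim to reproduce);
* the named facts `Prop_1_8_i`, `Prop_1_8_ii` for arbitrary classes `η ∈ P_U` (relative to `M`).

HONEST FRAMING: typed ≠ discharged; nothing here bears on [IUTchIII] Cor. 3.12.
-/

noncomputable section

open CategoryTheory
open scoped Classical

universe u

namespace Literature.AnabelianGeometry.AbsoluteAnabelian.AbsTopIII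

namespace IntrinsicKummerModel

variable (M : IntrinsicKummerModel.{u})

/-- The Kummer map `κ_U` written additively: `Γ(U, 𝒪_U^×) → H¹(Π_U, M_X)`.
[cite: MochizukiAbsTopIII2015, Prop 1.6 p.34] -/
def kummerAddHom {U X : M.Curve} (h : M.IsCofiniteOpen U X) (hX : M.IsProper X) :
    Additive (M.regularUnits U) →+ cyclotomeModH1 (M.res h) ZHatCoeff.{u} :=
  MonoidHom.toAdditiveLeft (M.kummerMap h hX)

/-- `kummerAddHom` is `κ_U`. [cite: MochizukiAbsTopIII2015, Prop 1.6 p.34] -/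
@[simp] theorem kummerAddHom_apply {U X : M.Curve} (h : M.IsCofiniteOpen U X) (hX : M.IsProper X)
    (f : M.regularUnits U) :
    M.kummerAddHom h hX (Additive.ofMul f) = Multiplicative.toAdd (M.kummerMap h hX f) :=
  rfl

/-- **`κ_U(Γ(U, 𝒪_U^×))`** — the Kummer classes of regular units, a subgroup of `H¹(Π_U, M_X)`.
[cite: MochizukiAbsTopIII2015, Prop 1.8 p.36] -/
def kummerImage {U X : M.Curve} (h : M.IsCofiniteOpen U X) (hX : M.IsProper X) :
    AddSubgroup (cyclotomeModH1 (M.res h) ZHatCoeff.{u}) :=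
  (M.kummerAddHom h hX).range

/-- Kummer classes of units lie in `kummerImage`. [cite: MochizukiAbsTopIII2015, Prop 1.8 p.36] -/
theorem kummer_mem_kummerImage {U X : M.Curve} (h : M.IsCofiniteOpen U X) (hX : M.IsProper X)
    (f : M.regularUnits U) :
    Multiplicative.toAdd (M.kummerMap h hX f) ∈ M.kummerImage h hX :=
  ⟨Additive.ofMul f, rfl⟩

/-- **`H¹(G_k, M_X) ⊆ H¹(Π_U, M_X)`** realised as the classes with vanishing restriction to `Δ_U`
(inflation–restriction: `Im(inf) = Ker(res_{Δ_U})`; "`P_U ⋂ H¹(G_k, M_X)`", Prop. 1.8 (ii) p. 36;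
"`(k^×)^∧ → H¹(Π_U, M_X)`", Prop. 1.6 (iii) p. 35). [cite: MochizukiAbsTopIII2015, Prop 1.8 (ii) p.36] -/
def galoisClasses {U X : M.Curve} (h : M.IsCofiniteOpen U X) :
    AddSubgroup (cyclotomeModH1 (M.res h) ZHatCoeff.{u}) :=
  (LinearMap.ker
    ((cyclotomeModH1Res (M.res h) ZHatCoeff.{u} (M.ext U).geom).hom.toLinearMap)).toAddSubgroup

/-- Membership in `galoisClasses`: the restriction to `Δ_U` vanishes.
[cite: MochizukiAbsTopIII2015, Prop 1.8 (ii) p.36] -/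
theorem mem_galoisClasses_iff {U X : M.Curve} (h : M.IsCofiniteOpen U X)
    (η : cyclotomeModH1 (M.res h) ZHatCoeff.{u}) :
    η ∈ M.galoisClasses h ↔ cyclotomeModH1Res (M.res h) ZHatCoeff.{u} (M.ext U).geom η = 0 :=
  Iff.rfl

/-- **`P_U ⊆ H¹(Π_U, M_X)`** (Prop. 1.8 p. 36; Thm. 1.9 (c) p. 37), in the tree's form
`P_U := κ_U(Γ(U, 𝒪_U^×)) ⊔ Ker(res_{Δ_U})` — equal to "the inverse image of the submodule of
`⊕_{x ∈ S} ℤ ⊆ ⊕_{x ∈ S} Ẑ` determined by the cuspidal principal divisors" whenever the exact sequence of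
Prop. 1.6 (iii) holds (`D ∘ κ_U = div`, `Ker D = (k^×)^∧ = Ker res_{Δ_U}`).  Tree definition relative
to the model (it uses the model's `κ_U`), NOT the group-theoretic construction of Thm. 1.9 (c).
[cite: MochizukiAbsTopIII2015, Thm 1.9 (c) p.37] -/
def PU {U X : M.Curve} (h : M.IsCofiniteOpen U X) (hX : M.IsProper X) :
    AddSubgroup (cyclotomeModH1 (M.res h) ZHatCoeff.{u}) :=
  M.kummerImage h hX ⊔ M.galoisClasses h

/-- `κ_U(Γ(U, 𝒪_U^×)) ⊆ P_U`. [cite: MochizukiAbsTopIII2015, Prop 1.8 p.36] -/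
theorem kummerImage_le_PU {U X : M.Curve} (h : M.IsCofiniteOpen U X) (hX : M.IsProper X) :
    M.kummerImage h hX ≤ M.PU h hX :=
  le_sup_left

/-- `H¹(G_k, M_X) ⊆ P_U` ("`P_U ⋂ H¹(G_k, M_X)`" is all of `H¹(G_k, M_X) ≅ (k^×)^∧`).
[cite: MochizukiAbsTopIII2015, Prop 1.8 (ii) p.36] -/
theorem galoisClasses_le_PU {U X : M.Curve} (h : M.IsCofiniteOpen U X) (hX : M.IsProper X) :
    M.galoisClasses h ≤ M.PU h hX :=
  le_sup_right

/-- The Kummer class of a regular unit lies in `P_U`. [cite: MochizukiAbsTopIII2015, Prop 1.8 p.36] -/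
theorem kummer_mem_PU {U X : M.Curve} (h : M.IsCofiniteOpen U X) (hX : M.IsProper X)
    (f : M.regularUnits U) : Multiplicative.toAdd (M.kummerMap h hX f) ∈ M.PU h hX :=
  M.kummerImage_le_PU h hX (M.kummer_mem_kummerImage h hX f)

/-- Restriction of a class `η ∈ H¹(Π_U, M_X)` to a subgroup ("`η|_x`" for a decomposition group `D_x`,
Prop. 1.8 p. 36). [cite: MochizukiAbsTopIII2015, Prop 1.8 (i) p.36] -/
def classRes {U X : M.Curve} (h : M.IsCofiniteOpen U X) (D : Subgroup (M.ext U).arith)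
    (η : cyclotomeModH1 (M.res h) ZHatCoeff.{u}) :=
  cyclotomeModH1Res (M.res h) ZHatCoeff.{u} D η

/-- `classRes` of a Kummer class is `kummerRes`. [cite: MochizukiAbsTopIII2015, Prop 1.8 (i) p.36] -/
theorem classRes_kummer {U X : M.Curve} (h : M.IsCofiniteOpen U X) (hX : M.IsProper X)
    (D : Subgroup (M.ext U).arith) (f : M.regularUnits U) :
    M.classRes h D (Multiplicative.toAdd (M.kummerMap h hX f)) = M.kummerRes h hX D f :=
  rfl

/-- **Prop. 1.8 (i), relative to `M`** ("A class `η ∈ P_U` is the Kummer class of a nonconstant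
NF-rational function if and only if there exist a positive multiple `η†` of `η` and NF-points
`x₁, x₂ ∈ U(k_x)`, where `k_x` is a finite extension of `k`, such that `η†|_{x₁} = 0`,
`η†|_{x₂} ≠ 0`", p. 36), for `U = X ∖ S`, `S ⊆ X(k)` (all cusps rational), `U` an NF-curve over a
Kummer-faithful `k`, `X` proper scheme-like of genus `≥ 2`; restrictions to the decomposition groups
of the model's NF-points.  NAMED FACT relative to `M` (with the tree's `P_U`).
[cite: MochizukiAbsTopIII2015, Prop 1.8 (i) p.36] -/
def Prop_1_8_i (M : IntrinsicKummerModel.{u}) : Prop :=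
  ∀ (U X : M.Curve) (h : M.IsCofiniteOpen U X) (hX : M.IsProper X), M.IsScheme U → M.IsScheme X →
    2 ≤ M.genus X → IsKummerFaithful (M.base U) →
      (∀ c : (M.cusps U).Cusp, (M.cusps U).IsRational c) → M.IsNFCurve U →
        ∀ η ∈ M.PU h hX,
          (∃ f : M.regularUnits U,
              M.IsNFRational U ((f : (M.FunctionField U)ˣ) : M.FunctionField U) ∧
                ¬ M.IsConstantUnit (f : (M.FunctionField U)ˣ) ∧
                  Multiplicative.toAdd (M.kummerMap h hX f) = η) ↔
            ∃ n : ℕ, 0 < n ∧ ∃ x₁ x₂ : M.Point U, M.IsNFPoint U x₁ ∧ M.IsNFPoint U x₂ ∧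
              M.classRes h (M.decomp U x₁) (n • η) = 0 ∧
                M.classRes h (M.decomp U x₂) (n • η) ≠ 0

/-- **Prop. 1.8 (ii), relative to `M`** ("Suppose that there exist nonconstant NF-rational functions
`∈ Γ(U, 𝒪_U^×)`. Then a class `η ∈ P_U ⋂ H¹(G_k, M_X)` is the Kummer class of an NF-constant `∈ k^×` if
and only if there exist a nonconstant NF-rational function `f ∈ Γ(U, 𝒪_U^×)` and an NF-point
`x ∈ U(k_x)` [...] such that `κ_U(f)|_x = η|_{G_{k_x}}`", p. 36) — with `P_U ⋂ H¹(G_k, M_X)` realised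
as `P_U ⊓ Ker(res_{Δ_U})` and `η|_{G_{k_x}}` as the restriction to the decomposition group `D_x`.
NAMED FACT relative to `M`. [cite: MochizukiAbsTopIII2015, Prop 1.8 (ii) p.36] -/
def Prop_1_8_ii (M : IntrinsicKummerModel.{u}) : Prop :=
  ∀ (U X : M.Curve) (h : M.IsCofiniteOpen U X) (hX : M.IsProper X), M.IsScheme U → M.IsScheme X →
    2 ≤ M.genus X → IsKummerFaithful (M.base U) →
      (∀ c : (M.cusps U).Cusp, (M.cusps U).IsRational c) → M.IsNFCurve U →
        (∃ g : M.regularUnits U,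
            M.IsNFRational U ((g : (M.FunctionField U)ˣ) : M.FunctionField U) ∧
              ¬ M.IsConstantUnit (g : (M.FunctionField U)ˣ)) →
          ∀ η ∈ M.PU h hX, η ∈ M.galoisClasses h →
            ((∃ (c : (M.base U)ˣ)
                (hc : Units.map (algebraMap (M.base U) (M.FunctionField U) : _ →* _) c ∈
                  M.regularUnits U),
                M.IsNFConstant U (c : M.base U) ∧
                  Multiplicative.toAdd (M.kummerMap h hX ⟨_, hc⟩) = η) ↔
              ∃ (f : M.regularUnits U) (y : M.Point U),
                M.IsNFRational U ((f : (M.FunctionField U)ˣ) : M.FunctionField U) ∧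
                  ¬ M.IsConstantUnit (f : (M.FunctionField U)ˣ) ∧ M.IsNFPoint U y ∧
                    M.classRes h (M.decomp U y) (Multiplicative.toAdd (M.kummerMap h hX f)) =
                      M.classRes h (M.decomp U y) η)

/-- **Prop. 1.6 (iii), exactness at `H¹(Π_U, M_X)`, relative to `M`** ("Suppose that `U = X ∖ S`,
where `S ⊆ X(k)` is a finite subset. Then restricting cohomology classes of `Π_U` to the various `I_x`
for `x ∈ S` yields a natural exact sequence `1 → (k^×)^∧ → H¹(Π_U, M_X) → ⊕_{x ∈ S} Ẑ`", p. 35): with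
`(k^×)^∧ = H¹(G_k, M_X)` realised inside `H¹(Π_U, M_X)` as `galoisClasses` (`= Ker res_{Δ_U}`,
inflation–restriction), a class has vanishing restriction to EVERY cuspidal inertia group iff it is a
Galois class.  (The identifications `Hom(I_x, M_X) ≅ Ẑ` — the synchronizations — and
`(k^×)^∧ ≅ H¹(G_k, M_X)` — Kummer theory over a Kummer-faithful `k` — are not typed.)  NAMED FACT
relative to `M`. [cite: MochizukiAbsTopIII2015, Prop 1.6 (iii) p.35] -/
def Prop_1_6_iii_ker (M : IntrinsicKummerModel.{u}) : Prop :=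
  ∀ (U X : M.Curve) (h : M.IsCofiniteOpen U X) (hX : M.IsProper X), M.IsScheme U → M.IsScheme X →
    2 ≤ M.genus X → IsKummerFaithful (M.base U) →
      (∀ c : (M.cusps U).Cusp, (M.cusps U).IsRational c) →
        ∀ η : cyclotomeModH1 (M.res h) ZHatCoeff.{u},
          (∀ c : (M.cusps U).Cusp, M.classRes h ((M.cusps U).Icusp c) η = 0) ↔
            η ∈ M.galoisClasses h

/-- **Prop. 1.6 (iii), compatibility `D ∘ κ_U = div` in kernel form, relative to `M`**: under the same
hypotheses, for a regular unit `f` and a cusp `c`, the restriction of `κ_U(f)` to `I_c` vanishes iff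
`f` extends to a unit at `c`, i.e. iff `ord_c(f) = 0` — typed through the proper curve `X ⊇ U`:
`κ_U(f)|_{I_c} = 0` for every cusp `c` iff `f` is a regular unit of `X` (no zeros or poles on `X`),
i.e. iff `f` is constant (`X` proper) — which is `Prop_1_6_iii_units` of `KummerIntrinsic.lean`;
recorded here as the special case `η = κ_U(f)` of `Prop_1_6_iii_ker` plus `Prop_1_6_i`.  DERIVED
remark, no new fact. [cite: MochizukiAbsTopIII2015, Prop 1.6 (iii) p.35] -/
theorem kummer_mem_galoisClasses_iff (hker : M.Prop_1_6_iii_ker) {U X : M.Curve}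
    (h : M.IsCofiniteOpen U X) (hX : M.IsProper X) (hU : M.IsScheme U) (hXs : M.IsScheme X)
    (hg : 2 ≤ M.genus X) (hk : IsKummerFaithful (M.base U))
    (hrat : ∀ c : (M.cusps U).Cusp, (M.cusps U).IsRational c) (f : M.regularUnits U) :
    Multiplicative.toAdd (M.kummerMap h hX f) ∈ M.galoisClasses h ↔
      ∀ c : (M.cusps U).Cusp, M.kummerRes h hX ((M.cusps U).Icusp c) f = 0 := by
  rw [← hker U X h hX hU hXs hg hk hrat]
  rfl

end IntrinsicKummerModel

end Literature.AnabelianGeometry.AbsoluteAnabelian.AbsTopIII
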